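import Literature.Computability.QuantumComplexity.ShallowCircuitsProofs
import HarnessLib

/-!
# BGK's constant-depth circuit for 2D HLF: the resource count made explicit

`hlf_quantum_constant_depth` (`ShallowCircuits.lean`, discharged in `ShallowCircuitsProofs.lean`)
hides the number `m` of ancilla qubits behind an existential. Statements about the class `QNC⁰`
(polynomial-size constant-depth quantum circuits WITHOUT advice — the ancillas are initialised to
`|0^m⟩` by `QCircuit.outputPMF`) need a polynomial bound on `m`; the construction of
`hlf_quantum_constant_depth_holds` has `m = N²` (one ancilla per grid vertex), depth `98`, for
every `N` (the hypothesis `2 ≤ N` of the named fact is not used by the construction). This file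
re-exports exactly that, with the same proof (Bravyi–Gosset–König 2018, Theorem 1 and its proof:
the circuit acts on the `n = N²` data qubits next to the classical input register).

* `hlf_quantum_circuit_explicit` — the concrete witnesses `hlfCircuit N`, `hlfOut`;
* `hlf_quantum_constant_depth_ancillas` — the named-fact shape with `m ≤ N²` added and no
  restriction on `N`.

## References

* S. Bravyi, D. Gosset, R. König, *Quantum advantage with shallow circuits*, Science 362 (2018)
  308–311, arXiv:1704.00690, Theorem 1 and §3 (the circuit on `n = N²` qubits)
  [BravyiGossetKonigScience2018].
-/

noncomputable section

namespace Literature.Computability.QuantumComplexity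

open Matrix Cryptography BGK

/-- **BGK Theorem 1, quantum half, explicit witnesses.** For every `N`, the Clifford+`T` circuit
`hlfCircuit N` on the `inLen N` input wires plus `N²` ancillas is oracle-free, has depth `≤ 98`,
the output-wire map `hlfOut` is injective, and on every valid instance `I` the measured output
restricted to the output wires lies in `hlfSolutions I` with probability `1`
(proof of `hlf_quantum_constant_depth_holds`, verbatim).
[cite: BravyiGossetKonigScience2018, Theorem 1] -/
theorem hlf_quantum_circuit_explicit (N : ℕ) :
    Function.Injective (hlfOut (N := N)) ∧ (hlfCircuit N).IsOracleFree ∧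
      (hlfCircuit N).depth ≤ 98 ∧
      ∀ I : HLFInstance N, I.IsValid →
        ((hlfCircuit N).outputPMF 0 (encodeHLF I)).toOuterMeasure
          {y | (fun v => y (hlfOut v)) ∈ hlfSolutions I} = 1 := by
  refine ⟨hlfOut_injective, hlfCircuit_isOracleFree, hlfCircuit_depth_le, fun I hI => ?_⟩
  rw [PMF.toOuterMeasure_apply_eq_one_iff]
  intro z hz
  rw [PMF.mem_support_iff,
    QCircuit.outputPMF_apply_holds cliffordT_isUnitary_holds 0 (hlfCircuit N) (encodeHLF I) z] at hz
  have hz' : ((hlfCircuit N).mat *ᵥ basisState (padInput (encodeHLF I) (N * N))) z ≠ 0 := by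
    intro h0
    apply hz
    change ENNReal.ofReal
      (‖((hlfCircuit N).mat *ᵥ basisState (padInput (encodeHLF I) (N * N))) z‖ ^ 2) = 0
    rw [h0, norm_zero, sq, zero_mul, ENNReal.ofReal_zero]
  rw [hlfCircuit_amplitude_encode I hI] at hz'
  apply mem_hlfSolutions_of_gamma_ne_zero
  intro hg
  apply hz'
  rw [hg, mul_zero, ite_self]

/-- **BGK Theorem 1, quantum half, with the ancilla bound** (the shape of
`hlf_quantum_constant_depth` plus `m ≤ N²`, for every `N`): there is a constant `d` (`= 98`)
such that for every grid size `N` some oracle-free Clifford+`T` circuit of depth `≤ d` on the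
`inLen N` input wires plus `m ≤ N²` ancillas initialised to `|0⟩`, with an injective choice of
`N²` output wires, solves every valid 2D HLF instance with certainty — i.e. 2D HLF ∈ `QNC⁰`
with no advice state. [cite: BravyiGossetKonigScience2018, Theorem 1] -/
theorem hlf_quantum_constant_depth_ancillas :
    ∃ d : ℕ, ∀ N : ℕ,
      ∃ (m : ℕ) (C : QCircuit cliffordT (inLen N + m)) (out : Fin N × Fin N → Fin (inLen N + m)),
        m ≤ N * N ∧ Function.Injective out ∧ C.IsOracleFree ∧ C.depth ≤ d ∧
        ∀ I : HLFInstance N, I.IsValid →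
          (C.outputPMF 0 (encodeHLF I)).toOuterMeasure
            {y | (fun v => y (out v)) ∈ hlfSolutions I} = 1 := by
  refine ⟨98, fun N => ⟨N * N, hlfCircuit N, hlfOut, le_rfl, ?_⟩⟩
  exact hlf_quantum_circuit_explicit N

end Literature.Computability.QuantumComplexity
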